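import Summits.QuantumFields.YangMills.Theorems.UnitScaleTiltProp7LocalLaplacianGaugeCovariance
import Summits.QuantumFields.YangMills.Theorems.UnitScaleTiltProp7TwoBackgroundGradientComparison
import HarnessLib

/-!
# Route `UnitScaleTilt`, crux K1 «MinimiserStabilityRegPr» (stmt-QuantumFields-19200), EX face after S45 — (L3′b)-GRAD, input of (G1-3b)(ii):
# **THE POINTWISE GAUGE-INVARIANCE GLUE** — the `WL2.equiv` readings of a gauge parameter `u`, of a vector field `A`, and of `D_{U₀}u`, `D*_{U₀}A`, `Δ^η_{U₀}u`
# are UNCHANGED, site by site and bond by bond, under the conjugation isometries `Φ_σ`∕`Ψ_σ` of ✓`Prop7LocalLaplacianGaugeCovariance.exists_adIsometries`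
# (px12 g13) that intertwine `U₀ ↦ U₀^σ`; plus the member-equation transport and the REVERSE flat-vs-covariant η-gradient row.

Cell `ym3-torus` (HUMAN RULING D-0037; rung R3 = SU(2) YM₃ on T³ — NOT d = 4, NOT infinite volume, NOT a mass gap, NOT Clay).  Width seat `ym3-torus-px10` (gen 12);
w5-19200 g14 LOCATE NOTE 2026-08-30 06:05:42Z («THE ONLY MISSING GLUE (≈ 40 l., def-free) … the POINTWISE `WL2.equiv` readings»), px12 g15 06:08:52Z (G1-3b)(i) SIGNATURE
(«(ii) MUST NOW SUPPLY … ✓`exists_curved_localGradient` at the cube axial gauge `U₀^σ` … pointwise `‖equiv (Φu) y‖ = ‖equiv u y‖` glue»).  THEOREMS ONLY (0 `def`,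
0 `sorry`, default heartbeats); `--supports stmt-QuantumFields-19200 --as helper`; count-neutral.

WHY.  (G1-3a) ✓`Prop7CurvedMemberLocalGradient.exists_curved_localGradient` bounds the η-gradient of a solution `u` of `Δ^η_V u + q = D*_V f` at the centre of a ball where the
background `V` is `δ`-close to `1`; (G1-3b)(ii) runs it in the cube axial gauge `V := U₀^σ` of a regular member `U₀`, on the transported column `Φ_σ u`.  Every analytic
letter of (G1-3a) is a sup of POINTWISE Frobenius norms (`M_u`, `M_q`, `M_f`) or an η-gradient sup `G`; this file says which of them are gauge invariants:
* the sups ARE (`‖(Φu)(y)‖ = ‖u(y)‖`, `‖(ΨA)(p)‖ = ‖A(p)‖` — §2), and so are the covariant readings `‖(D_{U₀^σ}Φu)(p)‖ = ‖(D_{U₀}u)(p)‖`, `‖(D*_{U₀^σ}ΨA)(y)‖ = ‖(D*_{U₀}A)(y)‖`,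
  `‖(Δ^η_{U₀^σ}Φu)(y)‖ = ‖(Δ^η_{U₀}u)(y)‖` (§3);
* the FLAT η-gradient `ℓ‖w(y+e_μ) − w(y)‖` of `w := Φu` is NOT, but it is within `ℓ·2√2·‖V(y,μ) − 1‖·‖w(y+e_μ)‖` of the covariant one (§4, the reverse of
  ✓`TwoBackgroundGradientComparison.norm_DL2_le`), so (G1-3a)'s letter `G` at `V = U₀^σ` is fed by the gauge-invariant covariant sup `sup_p ‖(D_{U₀}u)(p)‖` plus `(ℓδ)·2√2·M_u`.
CAVEAT (w5 g14, kept): moduli of continuity (`H_f`, differences `w(y′) − w(y)`) are NOT gauge invariant — `σ` varies over the ball; only sups and covariant readings are.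

WHAT IS PROVED (ns `Summit.QuantumFields.YangMills.Theorems.Prop7GaugeCovariancePointwise`; member `F`, heights `n K`, weight `c₀ > 0`, `σ` a gauge transformation).
* §1 fibre: `norm_frobEquiv_symm_conj_eq` — `‖(σXσ*)^∨‖ = ‖X^∨‖` in `W₂` (✓`sum_normSq_conj_eq` in the entries of `frobEquiv⁻¹`).
* §2 ★`norm_equiv_toL2S_conj_eq`, ★`norm_equiv_toL2_conj_eq` (the two carriers, by `toL2S_apply`∕`toL2_apply`); ★★`norm_equiv_adSite_eq (hΦ)`, ★★`norm_equiv_adBond_eq (hΨ)` — the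
  POINTWISE readings under the formula clauses of ✓`exists_adIsometries`, for every `u : SiteL2K`, `A : BondL2K`.
* §3 ★★`norm_equiv_DL2_gaugeAct_eq`, ★★`norm_equiv_DstarL2_gaugeAct_eq`, ★★`norm_equiv_covLapSite_gaugeAct_eq` (from the intertwining clauses) · ★`memberEquation_gaugeAct`
  (`Δ_{U₀}u + q = D*_{U₀}f → Δ_{U₀^σ}(Φu) + Φq = D*_{U₀^σ}(Ψf)`) · `covLapSite_gaugeAct_eq_of_eq` (sourced form).
* §4 ★`equiv_DL2_one_apply` (`(D_1 u)(y,μ) = η⁻¹•(u(y+e_μ) − u(y))`) · ★`norm_equiv_DL2_one` (`‖(D_1u)(y,μ)‖ = ℓ‖u(y+e_μ) − u(y)‖`) · ★★`ell_mul_norm_sub_le_norm_DL2_add` — THE REVERSE ROW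
  `ℓ‖u(y+e_μ) − u(y)‖ ≤ ‖(D_V u)(y,μ)‖ + ℓ·2√2·‖V(y,μ) − 1‖·‖u(y+e_μ)‖` · ★★`ell_mul_norm_sub_le_of_rows` (letters: `… ≤ Gcov + 2√2·(ℓδ)·Mu`).
* §5 ★★★`exists_adIsometries_pointwise (σ)` — ✓`exists_adIsometries` RE-EXPORTED with the two pointwise clauses of §2 and, for every `U₀`, the three intertwinings AND the three
  pointwise operator identities of §3: ONE `obtain` for the consumer.
HYP-SAT (★★OWNER RULING №42).  Hypotheses are the formula∕intertwining clauses of ✓`exists_adIsometries` (inhabited by that theorem for every `σ` — §5 discharges them) and, in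
§3∕§4, an equation or nothing; conclusions are equalities∕real inequalities between displayed terms; no `Prop`-valued hypothesis restates a conclusion.
HONEST SCOPE.  Bookkeeping over landed rows (px12 g13's isometries, routeR-w3∕px12's stencils, ★p1's two-background rows); no estimate of print is proved here; nothing of
(G1-3b), V6's `hDcol`, the ten EX print rows, `hThm2S`, EX `stub_existenceMinimalOrbit`, or the crux; the Yang–Mills mass gap is NOT proved.

References: T. Bałaban, CMP **99** (1985) 389–434 [Balaban1985BackgroundPropagators] ((3.3) p.391, (3.8) p.392, (3.11) p.392, (3.23) p.394, p.393 «all the operators … are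
covariant with respect to gauge transformations»); CMP **98** (1985) 17–51 [Balaban1985Averaging] ((18)–(19) p.21).
-/

set_option autoImplicit false

noncomputable section

open scoped Matrix.Norms.L2Operator BigOperators Matrix InnerProductSpace

namespace Summit.QuantumFields.YangMills.Theorems.Prop7GaugeCovariancePointwise

open Literature.MathematicalPhysics.QuantumFieldTheory.Balaban1983to89
open Literature.MathematicalPhysics.QuantumFieldTheory.Balaban1983to89.T3ContinuumYM3Torus
open B4Sect5Torus (TSite)
open B9SectCLatticeCarrier (Bond shift)
open B9Eq311L2Pairing (WL2)
open B11Eq103H1Complex (SiteL2K BondL2K)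
open T3SectALandauChart (eta eta_pos)
open Summit.QuantumFields.YangMills.Theorems.Prop7SectET3Transport (periodsT3 bondEquiv bgOfCfg)
open Summit.QuantumFields.YangMills.Theorems.Prop7SectET3HilbertLetters (W₂ frobEquiv frobEquiv_symm_apply_apply adBg toL2 toL2S toL2_apply toL2S_apply DL2 DstarL2 covLapSite)
open Summit.QuantumFields.YangMills.Theorems.Prop7LocalDivergenceComparison (sum_normSq_conj_eq)
open Summit.QuantumFields.YangMills.Theorems.Prop7LocalLaplacianGaugeCovariance (exists_adIsometries)
open Summit.QuantumFields.YangMills.Theorems.Prop7FlatGaugeProjectorTower (adBg_one_eq)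
open Summit.QuantumFields.YangMills.Theorems.Prop7TwoBackgroundGradientComparison (equiv_DL2_apply norm_inv_eta norm_DL2_sub_DL2_one_le)

/-! ## §1 The fibre: conjugation by `SU(2)` is a Frobenius isometry -/

/-- `‖(σ X σ*)^∨‖ = ‖X^∨‖` in the Hilbert fibre `W₂` (Frobenius norm), for `σ ∈ SU(2)`. [cite: Balaban1985Averaging, (18) p.21] -/
theorem norm_frobEquiv_symm_conj_eq (s : Matrix.specialUnitaryGroup (Fin 2) ℂ) (X : Matrix (Fin 2) (Fin 2) ℂ) :
    ‖(frobEquiv.symm ((s : Matrix (Fin 2) (Fin 2) ℂ) * X * star (s : Matrix (Fin 2) (Fin 2) ℂ)) : W₂)‖ = ‖(frobEquiv.symm X : W₂)‖ := by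
  have hsq : ∀ Y : Matrix (Fin 2) (Fin 2) ℂ, ‖(frobEquiv.symm Y : W₂)‖ ^ 2 = ∑ i, ∑ j, ‖Y i j‖ ^ 2 := fun Y => by
    rw [EuclideanSpace.norm_sq_eq, Fintype.sum_prod_type]
    simp only [frobEquiv_symm_apply_apply]
  have h : ‖(frobEquiv.symm ((s : Matrix (Fin 2) (Fin 2) ℂ) * X * star (s : Matrix (Fin 2) (Fin 2) ℂ)) : W₂)‖ ^ 2 = ‖(frobEquiv.symm X : W₂)‖ ^ 2 := by
    rw [hsq, hsq, sum_normSq_conj_eq]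
  exact (sq_eq_sq₀ (norm_nonneg _) (norm_nonneg _)).1 h

/-! ## §2 The pointwise readings of the two carriers and of the conjugation isometries -/

section Carriers

variable (F : T3Family) (K : ℕ) (c₀ : ℝ) [Fact (0 < c₀)]

omit [Fact (0 < c₀)] in
/-- ★ **SITE CARRIER, POINTWISE**: `‖(Ad_σλ)~(y)‖ = ‖λ̃(y)‖` for every site `y` of the finest torus. [cite: Balaban1985BackgroundPropagators, (3.11) p.392, p.393] -/
theorem norm_equiv_toL2S_conj_eq (σ : GaugeTransf (F.P K) 0 (Matrix.specialUnitaryGroup (Fin 2) ℂ)) (l : Site (F.P K) 0 → Matrix (Fin 2) (Fin 2) ℂ)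
    (y : TSite 3 (periodsT3 F K)) :
    ‖WL2.equiv ℂ (fun _ : TSite 3 (periodsT3 F K) => c₀) W₂
        (toL2S F K c₀ (fun x => (σ x : Matrix (Fin 2) (Fin 2) ℂ) * l x * star (σ x : Matrix (Fin 2) (Fin 2) ℂ))) y‖
      = ‖WL2.equiv ℂ (fun _ : TSite 3 (periodsT3 F K) => c₀) W₂ (toL2S F K c₀ l) y‖ := by
  rw [toL2S_apply, toL2S_apply]
  exact norm_frobEquiv_symm_conj_eq _ _

omit [Fact (0 < c₀)] in
/-- ★ **BOND CARRIER, POINTWISE**: `‖(Ad_σX)~(p)‖ = ‖X̃(p)‖` for every bond `p` of the finest torus (source conjugation). [cite: Balaban1985BackgroundPropagators, (3.11) p.392, p.393] -/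
theorem norm_equiv_toL2_conj_eq (σ : GaugeTransf (F.P K) 0 (Matrix.specialUnitaryGroup (Fin 2) ℂ)) (X : PBond (F.P K) 0 → Matrix (Fin 2) (Fin 2) ℂ)
    (p : Bond 3 (periodsT3 F K)) :
    ‖WL2.equiv ℂ (fun _ : Bond 3 (periodsT3 F K) => c₀) W₂
        (toL2 F K c₀ (fun b => (σ b.src : Matrix (Fin 2) (Fin 2) ℂ) * X b * star (σ b.src : Matrix (Fin 2) (Fin 2) ℂ))) p‖
      = ‖WL2.equiv ℂ (fun _ : Bond 3 (periodsT3 F K) => c₀) W₂ (toL2 F K c₀ X) p‖ := by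
  rw [toL2_apply, toL2_apply]
  exact norm_frobEquiv_symm_conj_eq _ _

/-- ★★ **THE SITE ISOMETRY `Φ_σ` IS A POINTWISE ISOMETRY**: under the formula clause of ✓`exists_adIsometries`, `‖(Φu)(y)‖ = ‖u(y)‖` for every `u` and every site `y` — so every
sup letter `sup_{y ∈ S} ‖u(y)‖` (`M_u`, `M_q` of (G1-3a)) is the same for `u` and `Φu`. [cite: Balaban1985BackgroundPropagators, (3.11) p.392, p.393] -/
theorem norm_equiv_adSite_eq (σ : GaugeTransf (F.P K) 0 (Matrix.specialUnitaryGroup (Fin 2) ℂ))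
    (Φ : SiteL2K ℂ 3 (periodsT3 F K) c₀ W₂ ≃ₗᵢ[ℂ] SiteL2K ℂ 3 (periodsT3 F K) c₀ W₂)
    (hΦ : ∀ l : Site (F.P K) 0 → Matrix (Fin 2) (Fin 2) ℂ,
      Φ (toL2S F K c₀ l) = toL2S F K c₀ (fun x => (σ x : Matrix (Fin 2) (Fin 2) ℂ) * l x * star (σ x : Matrix (Fin 2) (Fin 2) ℂ)))
    (u : SiteL2K ℂ 3 (periodsT3 F K) c₀ W₂) (y : TSite 3 (periodsT3 F K)) :
    ‖WL2.equiv ℂ (fun _ : TSite 3 (periodsT3 F K) => c₀) W₂ (Φ u) y‖ = ‖WL2.equiv ℂ (fun _ : TSite 3 (periodsT3 F K) => c₀) W₂ u y‖ := by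
  obtain ⟨l, rfl⟩ : ∃ l, u = toL2S F K c₀ l := ⟨(toL2S F K c₀).symm u, by rw [LinearEquiv.apply_symm_apply]⟩
  rw [hΦ]
  exact norm_equiv_toL2S_conj_eq F K c₀ σ l y

/-- ★★ **THE BOND ISOMETRY `Ψ_σ` IS A POINTWISE ISOMETRY**: under the formula clause of ✓`exists_adIsometries`, `‖(ΨA)(p)‖ = ‖A(p)‖` for every `A` and every bond `p` — so every
sup letter `sup_{p} ‖A(p)‖` (`M_f` of (G1-3a)) is the same for `A` and `ΨA`. [cite: Balaban1985BackgroundPropagators, (3.11) p.392, p.393] -/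
theorem norm_equiv_adBond_eq (σ : GaugeTransf (F.P K) 0 (Matrix.specialUnitaryGroup (Fin 2) ℂ))
    (Ψ : BondL2K ℂ 3 (periodsT3 F K) c₀ W₂ ≃ₗᵢ[ℂ] BondL2K ℂ 3 (periodsT3 F K) c₀ W₂)
    (hΨ : ∀ X : PBond (F.P K) 0 → Matrix (Fin 2) (Fin 2) ℂ,
      Ψ (toL2 F K c₀ X) = toL2 F K c₀ (fun b => (σ b.src : Matrix (Fin 2) (Fin 2) ℂ) * X b * star (σ b.src : Matrix (Fin 2) (Fin 2) ℂ)))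
    (A : BondL2K ℂ 3 (periodsT3 F K) c₀ W₂) (p : Bond 3 (periodsT3 F K)) :
    ‖WL2.equiv ℂ (fun _ : Bond 3 (periodsT3 F K) => c₀) W₂ (Ψ A) p‖ = ‖WL2.equiv ℂ (fun _ : Bond 3 (periodsT3 F K) => c₀) W₂ A p‖ := by
  obtain ⟨X, rfl⟩ : ∃ X, A = toL2 F K c₀ X := ⟨(toL2 F K c₀).symm A, by rw [LinearEquiv.apply_symm_apply]⟩
  rw [hΨ]
  exact norm_equiv_toL2_conj_eq F K c₀ σ X p

end Carriers

/-! ## §3 The covariant readings `D_{U₀}u`, `D*_{U₀}A`, `Δ^η_{U₀}u` are pointwise gauge invariants; the member equation transports -/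

section Operators

variable (F : T3Family) (n K : ℕ) (c₀ : ℝ) [Fact (0 < c₀)]

/-- ★★ **`‖(D_{U₀^σ}Φu)(p)‖ = ‖(D_{U₀}u)(p)‖` AT EVERY BOND** — the covariant η-gradient's pointwise size is a gauge invariant (intertwining clause `D_{U₀^σ}∘Φ = Ψ∘D_{U₀}` ⊕ §2).
[cite: Balaban1985BackgroundPropagators, (3.3) p.391, p.393] -/
theorem norm_equiv_DL2_gaugeAct_eq (σ : GaugeTransf (F.P K) 0 (Matrix.specialUnitaryGroup (Fin 2) ℂ)) (U₀ : GaugeField (F.P K) 0 (Matrix.specialUnitaryGroup (Fin 2) ℂ))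
    (Φ : SiteL2K ℂ 3 (periodsT3 F K) c₀ W₂ ≃ₗᵢ[ℂ] SiteL2K ℂ 3 (periodsT3 F K) c₀ W₂)
    (Ψ : BondL2K ℂ 3 (periodsT3 F K) c₀ W₂ ≃ₗᵢ[ℂ] BondL2K ℂ 3 (periodsT3 F K) c₀ W₂)
    (hΨ : ∀ X : PBond (F.P K) 0 → Matrix (Fin 2) (Fin 2) ℂ,
      Ψ (toL2 F K c₀ X) = toL2 F K c₀ (fun b => (σ b.src : Matrix (Fin 2) (Fin 2) ℂ) * X b * star (σ b.src : Matrix (Fin 2) (Fin 2) ℂ)))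
    (hD : ∀ x, DL2 F n K c₀ (GaugeField.gaugeAct σ U₀) (Φ x) = Ψ (DL2 F n K c₀ U₀ x))
    (u : SiteL2K ℂ 3 (periodsT3 F K) c₀ W₂) (p : Bond 3 (periodsT3 F K)) :
    ‖WL2.equiv ℂ (fun _ : Bond 3 (periodsT3 F K) => c₀) W₂ (DL2 F n K c₀ (GaugeField.gaugeAct σ U₀) (Φ u)) p‖
      = ‖WL2.equiv ℂ (fun _ : Bond 3 (periodsT3 F K) => c₀) W₂ (DL2 F n K c₀ U₀ u) p‖ := by
  rw [hD]
  exact norm_equiv_adBond_eq F K c₀ σ Ψ hΨ _ p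

/-- ★★ **`‖(D*_{U₀^σ}ΨA)(y)‖ = ‖(D*_{U₀}A)(y)‖` AT EVERY SITE** (intertwining clause `D*_{U₀^σ}∘Ψ = Φ∘D*_{U₀}` ⊕ §2). [cite: Balaban1985BackgroundPropagators, (3.8) p.392, p.393] -/
theorem norm_equiv_DstarL2_gaugeAct_eq (σ : GaugeTransf (F.P K) 0 (Matrix.specialUnitaryGroup (Fin 2) ℂ)) (U₀ : GaugeField (F.P K) 0 (Matrix.specialUnitaryGroup (Fin 2) ℂ))
    (Φ : SiteL2K ℂ 3 (periodsT3 F K) c₀ W₂ ≃ₗᵢ[ℂ] SiteL2K ℂ 3 (periodsT3 F K) c₀ W₂)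
    (Ψ : BondL2K ℂ 3 (periodsT3 F K) c₀ W₂ ≃ₗᵢ[ℂ] BondL2K ℂ 3 (periodsT3 F K) c₀ W₂)
    (hΦ : ∀ l : Site (F.P K) 0 → Matrix (Fin 2) (Fin 2) ℂ,
      Φ (toL2S F K c₀ l) = toL2S F K c₀ (fun x => (σ x : Matrix (Fin 2) (Fin 2) ℂ) * l x * star (σ x : Matrix (Fin 2) (Fin 2) ℂ)))
    (hDstar : ∀ A, DstarL2 F n K c₀ (GaugeField.gaugeAct σ U₀) (Ψ A) = Φ (DstarL2 F n K c₀ U₀ A))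
    (A : BondL2K ℂ 3 (periodsT3 F K) c₀ W₂) (y : TSite 3 (periodsT3 F K)) :
    ‖WL2.equiv ℂ (fun _ : TSite 3 (periodsT3 F K) => c₀) W₂ (DstarL2 F n K c₀ (GaugeField.gaugeAct σ U₀) (Ψ A)) y‖
      = ‖WL2.equiv ℂ (fun _ : TSite 3 (periodsT3 F K) => c₀) W₂ (DstarL2 F n K c₀ U₀ A) y‖ := by
  rw [hDstar]
  exact norm_equiv_adSite_eq F K c₀ σ Φ hΦ _ y

/-- ★★ **`‖(Δ^η_{U₀^σ}Φu)(y)‖ = ‖(Δ^η_{U₀}u)(y)‖` AT EVERY SITE** (intertwining clause `Δ^η_{U₀^σ}∘Φ = Φ∘Δ^η_{U₀}` ⊕ §2). [cite: Balaban1985BackgroundPropagators, (3.23) p.394, p.393] -/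
theorem norm_equiv_covLapSite_gaugeAct_eq (σ : GaugeTransf (F.P K) 0 (Matrix.specialUnitaryGroup (Fin 2) ℂ)) (U₀ : GaugeField (F.P K) 0 (Matrix.specialUnitaryGroup (Fin 2) ℂ))
    (Φ : SiteL2K ℂ 3 (periodsT3 F K) c₀ W₂ ≃ₗᵢ[ℂ] SiteL2K ℂ 3 (periodsT3 F K) c₀ W₂)
    (hΦ : ∀ l : Site (F.P K) 0 → Matrix (Fin 2) (Fin 2) ℂ,
      Φ (toL2S F K c₀ l) = toL2S F K c₀ (fun x => (σ x : Matrix (Fin 2) (Fin 2) ℂ) * l x * star (σ x : Matrix (Fin 2) (Fin 2) ℂ)))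
    (hΔ : ∀ x, covLapSite F n K c₀ (GaugeField.gaugeAct σ U₀) (Φ x) = Φ (covLapSite F n K c₀ U₀ x))
    (u : SiteL2K ℂ 3 (periodsT3 F K) c₀ W₂) (y : TSite 3 (periodsT3 F K)) :
    ‖WL2.equiv ℂ (fun _ : TSite 3 (periodsT3 F K) => c₀) W₂ (covLapSite F n K c₀ (GaugeField.gaugeAct σ U₀) (Φ u)) y‖
      = ‖WL2.equiv ℂ (fun _ : TSite 3 (periodsT3 F K) => c₀) W₂ (covLapSite F n K c₀ U₀ u) y‖ := by
  rw [hΔ]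
  exact norm_equiv_adSite_eq F K c₀ σ Φ hΦ _ y

/-- ★ **THE MEMBER EQUATION TRANSPORTS TO THE GAUGED BACKGROUND**: if `Δ^η_{U₀}u + q = D*_{U₀}f` then `Δ^η_{U₀^σ}(Φu) + Φq = D*_{U₀^σ}(Ψf)` — (G1-3a)'s hypothesis `h` at
`V := U₀^σ` for the transported data `(Φu, Φq, Ψf)`. [cite: Balaban1985BackgroundPropagators, (3.23) p.394, p.393] -/
theorem memberEquation_gaugeAct (σ : GaugeTransf (F.P K) 0 (Matrix.specialUnitaryGroup (Fin 2) ℂ)) (U₀ : GaugeField (F.P K) 0 (Matrix.specialUnitaryGroup (Fin 2) ℂ))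
    (Φ : SiteL2K ℂ 3 (periodsT3 F K) c₀ W₂ ≃ₗᵢ[ℂ] SiteL2K ℂ 3 (periodsT3 F K) c₀ W₂)
    (Ψ : BondL2K ℂ 3 (periodsT3 F K) c₀ W₂ ≃ₗᵢ[ℂ] BondL2K ℂ 3 (periodsT3 F K) c₀ W₂)
    (hDstar : ∀ A, DstarL2 F n K c₀ (GaugeField.gaugeAct σ U₀) (Ψ A) = Φ (DstarL2 F n K c₀ U₀ A))
    (hΔ : ∀ x, covLapSite F n K c₀ (GaugeField.gaugeAct σ U₀) (Φ x) = Φ (covLapSite F n K c₀ U₀ x))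
    {u q : SiteL2K ℂ 3 (periodsT3 F K) c₀ W₂} {f : BondL2K ℂ 3 (periodsT3 F K) c₀ W₂}
    (h : covLapSite F n K c₀ U₀ u + q = DstarL2 F n K c₀ U₀ f) :
    covLapSite F n K c₀ (GaugeField.gaugeAct σ U₀) (Φ u) + Φ q = DstarL2 F n K c₀ (GaugeField.gaugeAct σ U₀) (Ψ f) := by
  rw [hΔ, hDstar, ← map_add, h]

/-- **SOURCED FORM**: if `Δ^η_{U₀}u = s` then `Δ^η_{U₀^σ}(Φu) = Φs` (the column equation of V5∕V6 with the source transported). [cite: Balaban1985BackgroundPropagators, (3.23) p.394, p.393] -/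
theorem covLapSite_gaugeAct_eq_of_eq (σ : GaugeTransf (F.P K) 0 (Matrix.specialUnitaryGroup (Fin 2) ℂ)) (U₀ : GaugeField (F.P K) 0 (Matrix.specialUnitaryGroup (Fin 2) ℂ))
    (Φ : SiteL2K ℂ 3 (periodsT3 F K) c₀ W₂ ≃ₗᵢ[ℂ] SiteL2K ℂ 3 (periodsT3 F K) c₀ W₂)
    (hΔ : ∀ x, covLapSite F n K c₀ (GaugeField.gaugeAct σ U₀) (Φ x) = Φ (covLapSite F n K c₀ U₀ x))
    {u s : SiteL2K ℂ 3 (periodsT3 F K) c₀ W₂} (h : covLapSite F n K c₀ U₀ u = s) :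
    covLapSite F n K c₀ (GaugeField.gaugeAct σ U₀) (Φ u) = Φ s := by
  rw [hΔ, h]

end Operators

/-! ## §4 The flat η-gradient against the covariant one at a near-`1` background (the reverse of ✓`norm_DL2_le`) -/

section Reverse

variable (F : T3Family) (n K : ℕ) (c₀ : ℝ) [Fact (0 < c₀)]

/-- ★ **THE FLAT STENCIL**: `(D_1 u)(y,μ) = η⁻¹•(u(y+e_μ) − u(y))`. [cite: Balaban1985BackgroundPropagators, (3.3) p.391] -/
theorem equiv_DL2_one_apply (u : SiteL2K ℂ 3 (periodsT3 F K) c₀ W₂) (y : TSite 3 (periodsT3 F K)) (μ : Fin 3) :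
    WL2.equiv ℂ (fun _ : Bond 3 (periodsT3 F K) => c₀) W₂ (DL2 F n K c₀ 1 u) (y, μ) =
      ((((eta F n K : ℝ) : ℂ))⁻¹) • (WL2.equiv ℂ (fun _ : TSite 3 (periodsT3 F K) => c₀) W₂ u (shift μ y)
        - WL2.equiv ℂ (fun _ : TSite 3 (periodsT3 F K) => c₀) W₂ u y) := by
  rw [equiv_DL2_apply, adBg_one_eq, LinearMap.id_apply]

/-- ★ **`‖(D_1 u)(y,μ)‖ = ℓ·‖u(y+e_μ) − u(y)‖`** (`ℓ = L^{K−n} = η⁻¹`): the flat covariant reading IS (G1-3a)'s η-gradient letter. [cite: Balaban1985BackgroundPropagators, (3.3) p.391] -/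
theorem norm_equiv_DL2_one (u : SiteL2K ℂ 3 (periodsT3 F K) c₀ W₂) (y : TSite 3 (periodsT3 F K)) (μ : Fin 3) :
    ‖WL2.equiv ℂ (fun _ : Bond 3 (periodsT3 F K) => c₀) W₂ (DL2 F n K c₀ 1 u) (y, μ)‖ =
      (F.L : ℝ) ^ (K - n) * ‖WL2.equiv ℂ (fun _ : TSite 3 (periodsT3 F K) => c₀) W₂ u (shift μ y)
        - WL2.equiv ℂ (fun _ : TSite 3 (periodsT3 F K) => c₀) W₂ u y‖ := by
  rw [equiv_DL2_one_apply, norm_smul, norm_inv_eta]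

/-- ★★ **THE REVERSE ROW — FLAT η-GRADIENT ≤ COVARIANT η-GRADIENT + `(ℓδ)`·SIZE**: `ℓ‖u(y+e_μ) − u(y)‖ ≤ ‖(D_V u)(y,μ)‖ + ℓ·2√2·‖V(y,μ) − 1‖·‖u(y+e_μ)‖` (from `D_1 = D_V − B`,
`B = D_V − D_1`, ✓`norm_DL2_sub_DL2_one_le`).  With §3 at `V = U₀^σ`, `u := Φψ`: the flat η-gradient of the transported column is bounded by the GAUGE-INVARIANT covariant reading of `ψ`
plus `(ℓδ)·2√2·‖ψ(y+e_μ)‖`. [cite: Balaban1985BackgroundPropagators, (3.3) p.391; Balaban1985Averaging, (19) p.21] -/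
theorem ell_mul_norm_sub_le_norm_DL2_add (V : GaugeField (F.P K) 0 (Matrix.specialUnitaryGroup (Fin 2) ℂ)) (u : SiteL2K ℂ 3 (periodsT3 F K) c₀ W₂)
    (y : TSite 3 (periodsT3 F K)) (μ : Fin 3) :
    (F.L : ℝ) ^ (K - n) * ‖WL2.equiv ℂ (fun _ : TSite 3 (periodsT3 F K) => c₀) W₂ u (shift μ y) - WL2.equiv ℂ (fun _ : TSite 3 (periodsT3 F K) => c₀) W₂ u y‖ ≤
      ‖WL2.equiv ℂ (fun _ : Bond 3 (periodsT3 F K) => c₀) W₂ (DL2 F n K c₀ V u) (y, μ)‖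
        + (F.L : ℝ) ^ (K - n) * (2 * Real.sqrt 2 * ‖((bgOfCfg F K V (y, μ) : (Matrix (Fin 2) (Fin 2) ℂ)ˣ) : Matrix (Fin 2) (Fin 2) ℂ) - 1‖
          * ‖WL2.equiv ℂ (fun _ : TSite 3 (periodsT3 F K) => c₀) W₂ u (shift μ y)‖) := by
  have hsplit : WL2.equiv ℂ (fun _ : Bond 3 (periodsT3 F K) => c₀) W₂ (DL2 F n K c₀ 1 u) (y, μ) =
      WL2.equiv ℂ (fun _ : Bond 3 (periodsT3 F K) => c₀) W₂ (DL2 F n K c₀ V u) (y, μ)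
        - WL2.equiv ℂ (fun _ : Bond 3 (periodsT3 F K) => c₀) W₂ (DL2 F n K c₀ V u - DL2 F n K c₀ 1 u) (y, μ) := by
    rw [WL2.equiv_sub, Pi.sub_apply, sub_sub_cancel]
  calc (F.L : ℝ) ^ (K - n) * ‖WL2.equiv ℂ (fun _ : TSite 3 (periodsT3 F K) => c₀) W₂ u (shift μ y) - WL2.equiv ℂ (fun _ : TSite 3 (periodsT3 F K) => c₀) W₂ u y‖
        = ‖WL2.equiv ℂ (fun _ : Bond 3 (periodsT3 F K) => c₀) W₂ (DL2 F n K c₀ 1 u) (y, μ)‖ := (norm_equiv_DL2_one F n K c₀ u y μ).symm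
    _ = ‖WL2.equiv ℂ (fun _ : Bond 3 (periodsT3 F K) => c₀) W₂ (DL2 F n K c₀ V u) (y, μ)
          - WL2.equiv ℂ (fun _ : Bond 3 (periodsT3 F K) => c₀) W₂ (DL2 F n K c₀ V u - DL2 F n K c₀ 1 u) (y, μ)‖ := by rw [hsplit]
    _ ≤ ‖WL2.equiv ℂ (fun _ : Bond 3 (periodsT3 F K) => c₀) W₂ (DL2 F n K c₀ V u) (y, μ)‖
          + ‖WL2.equiv ℂ (fun _ : Bond 3 (periodsT3 F K) => c₀) W₂ (DL2 F n K c₀ V u - DL2 F n K c₀ 1 u) (y, μ)‖ := norm_sub_le _ _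
    _ ≤ _ := add_le_add le_rfl (norm_DL2_sub_DL2_one_le n V u y μ)

/-- ★★ **THE REVERSE ROW IN LETTERS**: from a covariant-gradient letter `‖(D_V u)(y,μ)‖ ≤ Gcov`, a closeness letter `‖V(y,μ) − 1‖ ≤ δ` and a size letter `‖u(y+e_μ)‖ ≤ Mu`,
`ℓ‖u(y+e_μ) − u(y)‖ ≤ Gcov + 2√2·(ℓδ)·Mu` — the shape (G1-3a)'s η-gradient hypothesis `hG` consumes, bond by bond. [cite: Balaban1985BackgroundPropagators, (3.3) p.391, Thm 3.1 (3.43) p.398] -/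
theorem ell_mul_norm_sub_le_of_rows (V : GaugeField (F.P K) 0 (Matrix.specialUnitaryGroup (Fin 2) ℂ)) (u : SiteL2K ℂ 3 (periodsT3 F K) c₀ W₂)
    (y : TSite 3 (periodsT3 F K)) (μ : Fin 3) {Gcov δ Mu : ℝ}
    (hG : ‖WL2.equiv ℂ (fun _ : Bond 3 (periodsT3 F K) => c₀) W₂ (DL2 F n K c₀ V u) (y, μ)‖ ≤ Gcov)
    (hδ : ‖((bgOfCfg F K V (y, μ) : (Matrix (Fin 2) (Fin 2) ℂ)ˣ) : Matrix (Fin 2) (Fin 2) ℂ) - 1‖ ≤ δ)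
    (hMu : ‖WL2.equiv ℂ (fun _ : TSite 3 (periodsT3 F K) => c₀) W₂ u (shift μ y)‖ ≤ Mu) :
    (F.L : ℝ) ^ (K - n) * ‖WL2.equiv ℂ (fun _ : TSite 3 (periodsT3 F K) => c₀) W₂ u (shift μ y) - WL2.equiv ℂ (fun _ : TSite 3 (periodsT3 F K) => c₀) W₂ u y‖ ≤
      Gcov + 2 * Real.sqrt 2 * ((F.L : ℝ) ^ (K - n) * δ) * Mu := by
  have hδ0 : 0 ≤ δ := (norm_nonneg _).trans hδ
  have hℓ : 0 ≤ (F.L : ℝ) ^ (K - n) := by positivity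
  calc (F.L : ℝ) ^ (K - n) * ‖WL2.equiv ℂ (fun _ : TSite 3 (periodsT3 F K) => c₀) W₂ u (shift μ y) - WL2.equiv ℂ (fun _ : TSite 3 (periodsT3 F K) => c₀) W₂ u y‖
        ≤ ‖WL2.equiv ℂ (fun _ : Bond 3 (periodsT3 F K) => c₀) W₂ (DL2 F n K c₀ V u) (y, μ)‖
          + (F.L : ℝ) ^ (K - n) * (2 * Real.sqrt 2 * ‖((bgOfCfg F K V (y, μ) : (Matrix (Fin 2) (Fin 2) ℂ)ˣ) : Matrix (Fin 2) (Fin 2) ℂ) - 1‖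
            * ‖WL2.equiv ℂ (fun _ : TSite 3 (periodsT3 F K) => c₀) W₂ u (shift μ y)‖) := ell_mul_norm_sub_le_norm_DL2_add F n K c₀ V u y μ
    _ ≤ Gcov + (F.L : ℝ) ^ (K - n) * (2 * Real.sqrt 2 * δ * Mu) :=
        add_le_add hG (mul_le_mul_of_nonneg_left
          (mul_le_mul (mul_le_mul_of_nonneg_left hδ (by positivity)) hMu (norm_nonneg _) (mul_nonneg (by positivity) hδ0)) hℓ)
    _ = Gcov + 2 * Real.sqrt 2 * ((F.L : ℝ) ^ (K - n) * δ) * Mu := by ring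

end Reverse

/-! ## §5 The packaged export: ✓`exists_adIsometries` with the pointwise clauses -/

section Export

variable (F : T3Family) (n K : ℕ) (c₀ : ℝ) [Fact (0 < c₀)]

/-- ★★★ **THE CONJUGATION ISOMETRIES WITH THEIR POINTWISE READINGS — ONE `obtain` FOR (G1-3b)(ii).**  For a gauge transformation `σ` there are linear isometries `Φ` of `SiteL2K`
and `Ψ` of `BondL2K` (✓`exists_adIsometries`: `Ad_σ` sitewise ∕ at the source) such that: the two formula clauses; the two POINTWISE isometry clauses `‖(Φu)(y)‖ = ‖u(y)‖`,
`‖(ΨA)(p)‖ = ‖A(p)‖`; and for EVERY background `U₀`: the three intertwinings `D_{U₀^σ}∘Φ = Ψ∘D_{U₀}`, `D*_{U₀^σ}∘Ψ = Φ∘D*_{U₀}`, `Δ^η_{U₀^σ}∘Φ = Φ∘Δ^η_{U₀}` AND the three pointwise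
identities `‖(D_{U₀^σ}Φu)(p)‖ = ‖(D_{U₀}u)(p)‖`, `‖(D*_{U₀^σ}ΨA)(y)‖ = ‖(D*_{U₀}A)(y)‖`, `‖(Δ^η_{U₀^σ}Φu)(y)‖ = ‖(Δ^η_{U₀}u)(y)‖`.
[cite: Balaban1985BackgroundPropagators, (3.3) p.391, (3.8) p.392, (3.11) p.392, (3.23) p.394, p.393] -/
theorem exists_adIsometries_pointwise (σ : GaugeTransf (F.P K) 0 (Matrix.specialUnitaryGroup (Fin 2) ℂ)) :
    ∃ (Φ : SiteL2K ℂ 3 (periodsT3 F K) c₀ W₂ ≃ₗᵢ[ℂ] SiteL2K ℂ 3 (periodsT3 F K) c₀ W₂)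
      (Ψ : BondL2K ℂ 3 (periodsT3 F K) c₀ W₂ ≃ₗᵢ[ℂ] BondL2K ℂ 3 (periodsT3 F K) c₀ W₂),
      (∀ l : Site (F.P K) 0 → Matrix (Fin 2) (Fin 2) ℂ,
          Φ (toL2S F K c₀ l) = toL2S F K c₀ (fun x => (σ x : Matrix (Fin 2) (Fin 2) ℂ) * l x * star (σ x : Matrix (Fin 2) (Fin 2) ℂ))) ∧
      (∀ X : PBond (F.P K) 0 → Matrix (Fin 2) (Fin 2) ℂ,
          Ψ (toL2 F K c₀ X) = toL2 F K c₀ (fun b => (σ b.src : Matrix (Fin 2) (Fin 2) ℂ) * X b * star (σ b.src : Matrix (Fin 2) (Fin 2) ℂ))) ∧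
      (∀ (u : SiteL2K ℂ 3 (periodsT3 F K) c₀ W₂) (y : TSite 3 (periodsT3 F K)),
          ‖WL2.equiv ℂ (fun _ : TSite 3 (periodsT3 F K) => c₀) W₂ (Φ u) y‖ = ‖WL2.equiv ℂ (fun _ : TSite 3 (periodsT3 F K) => c₀) W₂ u y‖) ∧
      (∀ (A : BondL2K ℂ 3 (periodsT3 F K) c₀ W₂) (p : Bond 3 (periodsT3 F K)),
          ‖WL2.equiv ℂ (fun _ : Bond 3 (periodsT3 F K) => c₀) W₂ (Ψ A) p‖ = ‖WL2.equiv ℂ (fun _ : Bond 3 (periodsT3 F K) => c₀) W₂ A p‖) ∧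
      ∀ U₀ : GaugeField (F.P K) 0 (Matrix.specialUnitaryGroup (Fin 2) ℂ),
        (∀ x, DL2 F n K c₀ (GaugeField.gaugeAct σ U₀) (Φ x) = Ψ (DL2 F n K c₀ U₀ x)) ∧
        (∀ A, DstarL2 F n K c₀ (GaugeField.gaugeAct σ U₀) (Ψ A) = Φ (DstarL2 F n K c₀ U₀ A)) ∧
        (∀ x, covLapSite F n K c₀ (GaugeField.gaugeAct σ U₀) (Φ x) = Φ (covLapSite F n K c₀ U₀ x)) ∧
        (∀ (u : SiteL2K ℂ 3 (periodsT3 F K) c₀ W₂) (p : Bond 3 (periodsT3 F K)),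
            ‖WL2.equiv ℂ (fun _ : Bond 3 (periodsT3 F K) => c₀) W₂ (DL2 F n K c₀ (GaugeField.gaugeAct σ U₀) (Φ u)) p‖
              = ‖WL2.equiv ℂ (fun _ : Bond 3 (periodsT3 F K) => c₀) W₂ (DL2 F n K c₀ U₀ u) p‖) ∧
        (∀ (A : BondL2K ℂ 3 (periodsT3 F K) c₀ W₂) (y : TSite 3 (periodsT3 F K)),
            ‖WL2.equiv ℂ (fun _ : TSite 3 (periodsT3 F K) => c₀) W₂ (DstarL2 F n K c₀ (GaugeField.gaugeAct σ U₀) (Ψ A)) y‖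
              = ‖WL2.equiv ℂ (fun _ : TSite 3 (periodsT3 F K) => c₀) W₂ (DstarL2 F n K c₀ U₀ A) y‖) ∧
        (∀ (u : SiteL2K ℂ 3 (periodsT3 F K) c₀ W₂) (y : TSite 3 (periodsT3 F K)),
            ‖WL2.equiv ℂ (fun _ : TSite 3 (periodsT3 F K) => c₀) W₂ (covLapSite F n K c₀ (GaugeField.gaugeAct σ U₀) (Φ u)) y‖
              = ‖WL2.equiv ℂ (fun _ : TSite 3 (periodsT3 F K) => c₀) W₂ (covLapSite F n K c₀ U₀ u) y‖) := by
  obtain ⟨Φ, Ψ, hΦ, hΨ, hU⟩ := exists_adIsometries F n K c₀ σ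
  refine ⟨Φ, Ψ, hΦ, hΨ, fun u y => norm_equiv_adSite_eq F K c₀ σ Φ hΦ u y, fun A p => norm_equiv_adBond_eq F K c₀ σ Ψ hΨ A p, fun U₀ => ?_⟩
  obtain ⟨hD, hDstar, hΔ⟩ := hU U₀
  exact ⟨hD, hDstar, hΔ, fun u p => norm_equiv_DL2_gaugeAct_eq F n K c₀ σ U₀ Φ Ψ hΨ hD u p,
    fun A y => norm_equiv_DstarL2_gaugeAct_eq F n K c₀ σ U₀ Φ Ψ hΦ hDstar A y,
    fun u y => norm_equiv_covLapSite_gaugeAct_eq F n K c₀ σ U₀ Φ hΦ hΔ u y⟩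

end Export

end Summit.QuantumFields.YangMills.Theorems.Prop7GaugeCovariancePointwise

end
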